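import Mathlib
import Literature.Barriers.ValiantsHypothesis.AlgebraicNaturalProofs
import Summits.ValiantsHypothesis.ValiantsHypothesis.Theorems.BarrierLeverNaturalProofsSeparateVNPSignSliceIntVec
import HarnessLib

/-!
# Item `BarrierLever.NaturalProofsSeparateVNP` (stmt-ValiantsHypothesis-18972), SIGN SLICE —
# part 6: integer coefficient vectors on an ARBITRARY finite monomial set (general degree)

Generalises part 0 (`…SignSliceIntVec.lean`, the case `M = degLEMonomials n` of FSV's frame `d = n`)
to an arbitrary finite set `M` of exponent vectors in `n` variables, as needed for the AS-PRINTED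
form of Chatterjee–Kumar–Ramya–Saptharishi–Tengse 2020 Thm. 1.1 (degree `≤ n^c`, coefficient
space `monomialsDegLE n (n^c)` of `CKRST20NaturalProofsExist.lean`):

* `Coeffs.poly c = ∑_{m ∈ M} c_m x^m`; `coeff_poly`, `coeffVector_poly`, `totalDegree_poly_le`,
  `poly_eq_zero_iff`, `poly_mem_signCoeffSlice`;
* `Coeffs.intEval a c = ∑_m c_m a^m` (`SignSlice.monoVal`), `eval_natCast_poly`, `natAbs_intEval_le`;
* `Coeffs.sgnVec M f`, `poly_sgnVec` (a sign polynomial supported on `M` IS `poly` of its vector);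
* `Coeffs.exists_witness` — Siegel's lemma in pigeonhole form: if `#M · B^d + 1 < 2^#M` and the
  monomials of `M` have degree `≤ d`, every `a ∈ [0, B]^n` admits a NONZERO `e ∈ {0,1,-1}^M` with
  `∑_m e_m a^m = 0`.

References: [ChatterjeeKumarRamyaSaptharishiTengse2020] §4; [ForbesShpilkaVolk2018] Def. 1.
-/

-- layout Summits/ValiantsHypothesis/ValiantsHypothesis forces the duplicated namespace component
set_option linter.dupNamespace false

noncomputable section

namespace Summit.ValiantsHypothesis.ValiantsHypothesis.Theorems.BarrierLever.NaturalProofsSeparateVNP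

open Literature.Barriers.ValiantsHypothesis Literature.Computability.AlgebraicComplexity MvPolynomial
open SignSlice (monoVal)

namespace Coeffs

variable {n : ℕ} {M : Set (Fin n →₀ ℕ)}

/-! ### Integer coefficient vectors as polynomials -/

section Poly

variable [Fintype M]

/-- The polynomial `∑_{m ∈ M} c_m x^m ∈ ℂ[x_1, …, x_n]`. [cite: ForbesShpilkaVolk2018, Def. 1] -/
def poly (c : M → ℤ) : MvPolynomial (Fin n) ℂ :=
  ∑ m : M, monomial (m : Fin n →₀ ℕ) (c m : ℂ)

/-- Coefficients of `poly c` on `M`. [cite: ForbesShpilkaVolk2018, Def. 1] -/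
theorem coeff_poly (c : M → ℤ) (m : M) : coeff (m : Fin n →₀ ℕ) (poly c) = c m := by
  classical
  unfold poly
  rw [coeff_sum, Finset.sum_eq_single m]
  · rw [coeff_monomial, if_pos rfl]
  · intro m' _ hm'
    rw [coeff_monomial, if_neg]
    exact fun h => hm' (Subtype.ext h)
  · intro h; exact absurd (Finset.mem_univ m) h

/-- Coefficients of `poly c` off `M` vanish. [cite: ForbesShpilkaVolk2018, Def. 1] -/
theorem coeff_poly_of_not_mem (c : M → ℤ) {μ : Fin n →₀ ℕ} (hμ : μ ∉ M) :
    coeff μ (poly c) = 0 := by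
  classical
  unfold poly
  rw [coeff_sum]
  refine Finset.sum_eq_zero fun m _ => ?_
  rw [coeff_monomial, if_neg]
  intro h; exact hμ (h ▸ m.2)

/-- The coefficient vector of `poly c` on `M` is `c`. [cite: ForbesShpilkaVolk2018, Def. 1] -/
theorem coeffVector_poly (c : M → ℤ) : coeffVector M (poly c) = fun m => (c m : ℂ) := by
  funext m; rw [coeffVector_apply, coeff_poly]

/-- `deg (poly c) ≤ d` when the monomials of `M` have degree `≤ d`. [cite: ForbesShpilkaVolk2018, Def. 1] -/
theorem totalDegree_poly_le {d : ℕ} (hM : ∀ m : M, (m : Fin n →₀ ℕ).degree ≤ d) (c : M → ℤ) :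
    (poly c).totalDegree ≤ d := by
  classical
  unfold poly
  refine totalDegree_finsetSum_le fun m _ => (totalDegree_monomial_le _ _).trans ?_
  have := hM m
  rwa [Finsupp.degree_apply] at this

/-- `poly c = 0 ↔ c = 0`. [cite: ForbesShpilkaVolk2018, Def. 1] -/
theorem poly_eq_zero_iff (c : M → ℤ) : poly c = 0 ↔ c = 0 := by
  constructor
  · intro h
    funext m
    have := coeff_poly c m
    rw [h, coeff_zero] at this
    exact_mod_cast this.symm
  · rintro rfl
    simp [poly]

/-- A `{0,1,-1}`-vector gives a member of the sign slice. [cite: ChatterjeeKumarRamyaSaptharishiTengse2020, Thm. 1.1] -/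
theorem poly_mem_signCoeffSlice {c : M → ℤ} (hc : ∀ m, c m = 0 ∨ c m = 1 ∨ c m = -1) :
    poly c ∈ signCoeffSlice ℂ n := by
  classical
  intro μ
  by_cases hμ : μ ∈ M
  · have := coeff_poly c ⟨μ, hμ⟩
    simp only at this
    rw [this]
    rcases hc ⟨μ, hμ⟩ with h | h | h <;> simp [h]
  · exact Or.inl (coeff_poly_of_not_mem c hμ)

end Poly

/-! ### Integer evaluation -/

/-- `a^m ≤ B^d` for `a ∈ [0, B]^n`, `B ≥ 1`, `deg m ≤ d`. [folklore] -/
theorem monoVal_le_pow_of_degree_le {a : Fin n → ℕ} {B d : ℕ} (hB : 1 ≤ B) (ha : ∀ i, a i ≤ B)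
    {m : Fin n →₀ ℕ} (hm : m.degree ≤ d) : monoVal a m ≤ B ^ d := by
  unfold SignSlice.monoVal
  calc ∏ i, a i ^ m i ≤ ∏ i, B ^ m i := Finset.prod_le_prod' fun i _ => Nat.pow_le_pow_left (ha i) _
    _ = B ^ (∑ i, m i) := Finset.prod_pow_eq_pow_sum _ _ _
    _ ≤ B ^ d := Nat.pow_le_pow_right hB (by rwa [Finsupp.degree_eq_sum] at hm)

section Eval

variable [Fintype M]

/-- The integer `∑_{m ∈ M} c_m a^m`. [cite: ChatterjeeKumarRamyaSaptharishiTengse2020, §4] -/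
def intEval (a : Fin n → ℕ) (c : M → ℤ) : ℤ :=
  ∑ m : M, c m * (monoVal a m : ℤ)

/-- `|∑_m c_m a^m| ≤ #M · B^d` for `|c_m| ≤ 1`, `a ∈ [0, B]^n`, degrees `≤ d`.
[cite: ChatterjeeKumarRamyaSaptharishiTengse2020, §4] -/
theorem natAbs_intEval_le {d : ℕ} (hM : ∀ m : M, (m : Fin n →₀ ℕ).degree ≤ d) {a : Fin n → ℕ}
    {B : ℕ} (hB : 1 ≤ B) (ha : ∀ i, a i ≤ B) {c : M → ℤ} (hc : ∀ m, (c m).natAbs ≤ 1) :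
    (intEval a c).natAbs ≤ Fintype.card M * B ^ d := by
  unfold intEval
  calc (∑ m, c m * (monoVal a m : ℤ)).natAbs
      ≤ ∑ m, (c m * (monoVal a m : ℤ)).natAbs := Int.natAbs_sum_le _ _
    _ ≤ ∑ _m : M, B ^ d := Finset.sum_le_sum fun m _ => by
        rw [Int.natAbs_mul, Int.natAbs_natCast]
        calc (c m).natAbs * monoVal a m ≤ 1 * B ^ d :=
              Nat.mul_le_mul (hc m) (monoVal_le_pow_of_degree_le hB ha (hM m))
          _ = B ^ d := one_mul _
    _ = Fintype.card M * B ^ d := by rw [Finset.sum_const, smul_eq_mul, Finset.card_univ]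

/-- `(poly c)(a) = intEval a c` in `ℂ`, for `a ∈ ℕ^n`. [cite: ChatterjeeKumarRamyaSaptharishiTengse2020, §4] -/
theorem eval_natCast_poly (a : Fin n → ℕ) (c : M → ℤ) :
    eval (fun i => (a i : ℂ)) (poly c) = (intEval a c : ℂ) := by
  unfold poly intEval SignSlice.monoVal
  rw [map_sum]
  push_cast
  refine Finset.sum_congr rfl fun m _ => ?_
  rw [eval_monomial]
  simp [Finsupp.prod_fintype]

end Eval

/-! ### From a member of the sign slice supported on `M` to its integer vector -/

/-- The integer coefficient vector on `M` of a polynomial with coefficients in `{0, 1, -1}`.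
[cite: ChatterjeeKumarRamyaSaptharishiTengse2020, Thm. 1.1] -/
def sgnVec (M : Set (Fin n →₀ ℕ)) (f : MvPolynomial (Fin n) ℂ) : M → ℤ := fun m =>
  if coeff (m : Fin n →₀ ℕ) f = 1 then 1 else if coeff (m : Fin n →₀ ℕ) f = -1 then -1 else 0

/-- Entries of `sgnVec M f` lie in `{0, 1, -1}`. [cite: ChatterjeeKumarRamyaSaptharishiTengse2020, Thm. 1.1] -/
theorem sgnVec_mem (f : MvPolynomial (Fin n) ℂ) (m : M) :
    sgnVec M f m = 0 ∨ sgnVec M f m = 1 ∨ sgnVec M f m = -1 := by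
  unfold sgnVec; split_ifs <;> simp

/-- Entries of `sgnVec M f` have absolute value `≤ 1`. [cite: ChatterjeeKumarRamyaSaptharishiTengse2020, Thm. 1.1] -/
theorem natAbs_sgnVec_le (f : MvPolynomial (Fin n) ℂ) (m : M) : (sgnVec M f m).natAbs ≤ 1 := by
  rcases sgnVec_mem f m with h | h | h <;> simp [h]

/-- On the sign slice, `sgnVec M f` casts back to the coefficients of `f`.
[cite: ChatterjeeKumarRamyaSaptharishiTengse2020, Thm. 1.1] -/
theorem cast_sgnVec {f : MvPolynomial (Fin n) ℂ} (hf : f ∈ signCoeffSlice ℂ n) (m : M) :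
    ((sgnVec M f m : ℤ) : ℂ) = coeff (m : Fin n →₀ ℕ) f := by
  unfold sgnVec
  rcases hf (m : Fin n →₀ ℕ) with h | h | h
  · rw [h]; simp
  · rw [h]; simp
  · rw [h]
    have : (-1 : ℂ) ≠ 1 := by norm_num
    simp [this]

/-- The coefficient vector of a sign polynomial is the cast of its integer vector.
[cite: ForbesShpilkaVolk2018, Def. 1] -/
theorem coeffVector_eq_cast_sgnVec {f : MvPolynomial (Fin n) ℂ} (hf : f ∈ signCoeffSlice ℂ n) :
    coeffVector M f = fun m => ((sgnVec M f m : ℤ) : ℂ) := by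
  funext m; rw [coeffVector_apply, cast_sgnVec hf]

section Supported

variable [Fintype M]

/-- A sign polynomial supported on `M` IS `poly` of its integer vector.
[cite: ChatterjeeKumarRamyaSaptharishiTengse2020, Thm. 1.1] -/
theorem poly_sgnVec {f : MvPolynomial (Fin n) ℂ} (hf : f ∈ signCoeffSlice ℂ n)
    (hsupp : ∀ μ, coeff μ f ≠ 0 → μ ∈ M) : poly (sgnVec M f) = f := by
  classical
  refine MvPolynomial.ext _ _ fun μ => ?_
  by_cases hμ : μ ∈ M
  · have := coeff_poly (sgnVec M f) ⟨μ, hμ⟩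
    simp only at this
    rw [this, cast_sgnVec hf]
  · rw [coeff_poly_of_not_mem _ hμ]
    by_contra h
    exact hμ (hsupp μ (Ne.symm h))

/-- Degree form: if `M` contains every exponent vector of degree `≤ d`, a sign polynomial of degree
`≤ d` IS `poly` of its integer vector. [cite: ChatterjeeKumarRamyaSaptharishiTengse2020, Thm. 1.1] -/
theorem poly_sgnVec_of_totalDegree_le {d : ℕ} (hMd : ∀ μ : Fin n →₀ ℕ, μ.degree ≤ d → μ ∈ M)
    {f : MvPolynomial (Fin n) ℂ} (hf : f ∈ signCoeffSlice ℂ n) (hdeg : f.totalDegree ≤ d) :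
    poly (sgnVec M f) = f := by
  refine poly_sgnVec hf fun μ hμ => hMd μ ?_
  by_contra hlt
  push Not at hlt
  refine hμ (coeff_eq_zero_of_totalDegree_lt (lt_of_le_of_lt hdeg ?_))
  rwa [Finsupp.degree_apply] at hlt

/-- Hence `f(a) = intEval a (sgnVec M f)` for such `f` and `a ∈ ℕ^n`.
[cite: ChatterjeeKumarRamyaSaptharishiTengse2020, §4] -/
theorem eval_natCast_eq_intEval {d : ℕ} (hMd : ∀ μ : Fin n →₀ ℕ, μ.degree ≤ d → μ ∈ M)
    {f : MvPolynomial (Fin n) ℂ} (hf : f ∈ signCoeffSlice ℂ n) (hdeg : f.totalDegree ≤ d)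
    (a : Fin n → ℕ) : eval (fun i => (a i : ℂ)) f = (intEval a (sgnVec M f) : ℂ) := by
  conv_lhs => rw [← poly_sgnVec_of_totalDegree_le hMd hf hdeg]
  exact eval_natCast_poly a _

/-! ### The Siegel witness -/

/-- **Siegel's lemma, pigeonhole form.** If `#M · B^d + 1 < 2^#M`, the monomials of `M` have degree
`≤ d`, and `a ∈ [0, B]^n` (`B ≥ 1`), some NONZERO `e ∈ {0,1,-1}^M` has `∑_m e_m a^m = 0`.
[cite: ChatterjeeKumarRamyaSaptharishiTengse2020, §4 (remark on the largeness)] -/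
theorem exists_witness {d : ℕ} (hM : ∀ m : M, (m : Fin n →₀ ℕ).degree ≤ d) (a : Fin n → ℕ)
    {B : ℕ} (hB : 1 ≤ B) (ha : ∀ i, a i ≤ B)
    (hlt : Fintype.card M * B ^ d + 1 < 2 ^ Fintype.card M) :
    ∃ e : M → ℤ, e ≠ 0 ∧ (∀ m, e m = 0 ∨ e m = 1 ∨ e m = -1) ∧ intEval a e = 0 := by
  classical
  set N := Fintype.card M with hN
  let natEval : (M → Fin 2) → ℕ := fun u => ∑ m, (u m : ℕ) * monoVal a m
  have hle : ∀ u, natEval u ≤ N * B ^ d := by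
    intro u
    calc natEval u = ∑ m, (u m : ℕ) * monoVal a m := rfl
      _ ≤ ∑ _m : M, B ^ d := Finset.sum_le_sum fun m _ => by
          calc (u m : ℕ) * monoVal a m ≤ 1 * B ^ d :=
                Nat.mul_le_mul (by have := (u m).isLt; omega)
                  (monoVal_le_pow_of_degree_le hB ha (hM m))
            _ = B ^ d := one_mul _
      _ = N * B ^ d := by rw [Finset.sum_const, smul_eq_mul, Finset.card_univ]
  have hmaps : ∀ u ∈ (Finset.univ : Finset (M → Fin 2)),
      natEval u ∈ Finset.range (N * B ^ d + 1) :=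
    fun u _ => Finset.mem_range.mpr (Nat.lt_succ_of_le (hle u))
  have hcard : (Finset.range (N * B ^ d + 1)).card < (Finset.univ : Finset (M → Fin 2)).card := by
    rw [Finset.card_range, Finset.card_univ, Fintype.card_fun, Fintype.card_fin]
    exact hlt
  obtain ⟨u, -, u', -, hne, heq⟩ := Finset.exists_ne_map_eq_of_card_lt_of_maps_to hcard hmaps
  refine ⟨fun m => (u m : ℕ) - (u' m : ℕ), ?_, ?_, ?_⟩
  · intro h0
    apply hne
    funext m
    have := congrFun h0 m
    simp only [Pi.zero_apply, sub_eq_zero, Nat.cast_inj] at this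
    exact Fin.ext this
  · intro m
    have h1 := (u m).isLt
    have h2 := (u' m).isLt
    interval_cases hu : (u m : ℕ) <;> interval_cases hu' : (u' m : ℕ) <;> simp [hu, hu']
  · have h : (natEval u : ℤ) = natEval u' := by exact_mod_cast heq
    simp only [intEval, sub_mul, Finset.sum_sub_distrib]
    simp only [natEval] at h
    push_cast at h
    linear_combination h

end Supported

end Coeffs

end Summit.ValiantsHypothesis.ValiantsHypothesis.Theorems.BarrierLever.NaturalProofsSeparateVNP
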